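import Summits.HodgeConjecture.HodgeConjecture.Theorems.NikulinTwinTransportSquarePairing
import Literature.AlgebraicGeometry.HodgeTheory.ComplexGysinHodgeType
import Literature.AlgebraicGeometry.HodgeTheory.HodgeTypePullback
import Literature.AlgebraicGeometry.HodgeTheory.HodgeFiltrationModelsReductionProofs

/-!
# Route NikulinTwinTransport · item `SquareHodgeOfSqrtTwo` (stmt-HodgeConjecture-13680) —
# Hodge types of Künneth components on the square of a surface

Third file of the Künneth bookkeeping for `S ⊗ S` (after `…SquareKunneth`, `…SquarePairing`).
Voisin, *Hodge Theory and Complex Algebraic Geometry I*, Lemma 11.41: "the Künneth components of a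
Hodge class on `X × Y` are morphisms of Hodge structures"; here on the tree's carriers, for a smooth
projective surface `S` with `a ∪ b = B(a, b) • p` on `H²(S(ℂ); ℂ)`, Hodge models `A` of `S` and `M`
of `S ⊗ S`, and the multiplicativity of Hodge types under `∪` on `S` and on `S ⊗ S`
(`CupPreservesHodgeType`, the tree's theorem from de Rham's theorem, taken as a hypothesis as
everywhere on the layer). The independence of Hodge types from the model is the tree's THEOREM
`hodgePQ_independent_of_hodgeModel_holds`.

* `isOfHodgeType_top_two_two` — every class of `H⁴(S(ℂ); ℂ)` is of type `(2,2)`;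
* `isOfHodgeType_cross` — `fst^* a ∪ snd^* b` has type `(p + p', q + q')` (Voisin I §7.3.2 +
  §11.3.3: pull-backs are morphisms of Hodge structures, types add under `∪`);
* `isOfHodgeType_act_of_normalForm`, `isOfHodgeType_coact_of_normalForm` — for a `(2,2)`-class
  `z = Σᵢ fst^* vᵢ ∪ snd^* uᵢ + t₄ • snd^* p + t₀ • fst^* p` on `S ⊗ S`, the two endomorphisms
  `x ↦ Σᵢ B(x, uᵢ) vᵢ` and `x ↦ Σᵢ B(x, vᵢ) uᵢ` of `H²(S(ℂ); ℂ)` read off from its middle Künneth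
  component preserve Hodge types (Lemma 11.41; proof through Lemma 7.30,
  `HodgeModel.mem_hodgePQ_of_forall_cupPairing_eq_zero`: `(f x) ∪ β` is a Künneth coefficient of
  `z ∪ (fst^* β ∪ snd^* x)`, which vanishes for `β` of non-complementary type by the types on `S ⊗ S`);
* `isOfHodgeType_of_kunneth_two`, `isOfHodgeType_of_kunneth_six` — the components `a`, `b` of a
  `(1,1)`-class `fst^* a + snd^* b`, resp. of a `(3,3)`-class `fst^* a ∪ snd^* p + fst^* p ∪ snd^* b`,
  are of type `(1,1)`.

## References

* [VoisinHodgeI2002] C. Voisin, Hodge Theory and Complex Algebraic Geometry I, CUP 2002, §7.3.2,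
  Lemma 7.30, §11.3.3 Lemma 11.41.
* [HatcherAT2002] A. Hatcher, Algebraic Topology, CUP 2002, §3.2 Thm. 3.16, §3.3 Prop. 3.38.
-/

noncomputable section

open CategoryTheory AlgebraicGeometry MonoidalCategory CartesianMonoidalCategory
open Literature.AlgebraicGeometry.Motives Literature.AlgebraicGeometry.HodgeTheory
open Literature.AlgebraicTopology.SingularHomology

namespace Summit.HodgeConjecture.HodgeConjecture.Theorems.NikulinTwinTransport

variable {S : SchemeOver ℂ}

/-! ### Top classes of a surface are of type `(2,2)`; cross products add types -/

/-- **Every class of `H⁴(S(ℂ); ℂ)` is of Hodge type `(2,2)`** (`S` a smooth projective surface with a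
Hodge model `A`): write it as the sum of its pure-type components (Hodge decomposition of the model,
`HodgeModel.exists_sum_eq_of_hodgeDecomposition`); every component of type `≠ (2,2)` vanishes in
the top degree (`HodgeModel.eq_zero_of_mem_hodgePQ_two_mul`). [cite: VoisinHodgeI2002, §6.1.3 and Cor. 6.14] -/
theorem isOfHodgeType_top_two_two (A : HodgeModel 2 S) (q : complexBetti S (2 * 2)) :
    IsOfHodgeType 2 S (2 * 2) 2 2 q := by
  obtain ⟨z, hz, hzt⟩ := A.exists_sum_eq_of_hodgeDecomposition (2 * 2) q
  have hq : q = z (2, 2) := by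
    rw [← hz, Finset.sum_eq_single_of_mem (2, 2)]
    · exact Finset.HasAntidiagonal.mem_antidiagonal.2 rfl
    · intro i hi hne
      exact A.eq_zero_of_mem_hodgePQ_two_mul hne (hzt i hi)
  rw [hq]
  exact ⟨A, hzt (2, 2) (Finset.HasAntidiagonal.mem_antidiagonal.2 rfl)⟩

/-- **`fst^* a ∪ snd^* b` is of type `(p + p', q + q')` on `S ⊗ S`** for `a` of type `(p, q)` and
`b` of type `(p', q')` on `S` (pull-backs preserve Hodge types, `IsOfHodgeType.map_of_independent`
with `hodgePQ_independent_of_hodgeModel_holds`; types add under `∪` on `S ⊗ S`).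
[cite: VoisinHodgeI2002, §7.3.2 and §11.3.3 Lemma 11.41] -/
theorem isOfHodgeType_cross (hS : IsSmoothProjective 2 S) (M : HodgeModel 4 (S ⊗ S))
    (hcupP : CupPreservesHodgeType 4 (S ⊗ S)) {k l m : ℕ} (h : k + l = m) {p q p' q' : ℕ}
    {a : complexBetti S k} {b : complexBetti S l} (ha : IsOfHodgeType 2 S k p q a)
    (hb : IsOfHodgeType 2 S l p' q' b) :
    IsOfHodgeType 4 (S ⊗ S) m (p + p') (q + q')
      (cupProduct h (complexBetti.map (fst S S) k a) (complexBetti.map (snd S S) l b)) :=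
  hcupP h
    (ha.map_of_independent hodgePQ_independent_of_hodgeModel_holds
      (IsSmoothProjective.tensor_holds hS hS) hS M (fst S S))
    (hb.map_of_independent hodgePQ_independent_of_hodgeModel_holds
      (IsSmoothProjective.tensor_holds hS hS) hS M (snd S S))

/-! ### The endomorphisms read off from a `(2,2)`-class preserve Hodge types -/

section TypeTwoTwo

variable (μ : OrientationFamily) (hS : IsSmoothProjective 2 S) (A : HodgeModel 2 S)
  (M : HodgeModel 4 (S ⊗ S)) (hcupS : CupPreservesHodgeType 2 S)
  (hcupP : CupPreservesHodgeType 4 (S ⊗ S)) {p : complexBetti S (2 * 2)}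
  {B : complexBetti S (2 * 1) → complexBetti S (2 * 1) → ℂ}
  (hB : ∀ a b : complexBetti S (2 * 1), cupProduct (rfl : 2 * 1 + 2 * 1 = 2 * 2) a b = B a b • p)
  (hBs : ∀ a b : complexBetti S (2 * 1), B a b = B b a)
  (hpp : cupProduct (rfl : 2 * 2 + 2 * 2 = 2 * 4) (complexBetti.map (fst S S) (2 * 2) p)
    (complexBetti.map (snd S S) (2 * 2) p) ≠ 0)

include μ hS A M hcupS hcupP hB hBs hpp

/-- **The endomorphism `x ↦ Σᵢ B(x, uᵢ) • vᵢ` read off from a `(2,2)`-class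
`z = Σᵢ fst^* vᵢ ∪ snd^* uᵢ + t₄ • snd^* p + t₀ • fst^* p` of `S ⊗ S` preserves Hodge types on
`H²(S(ℂ); ℂ)`** (Voisin I, Lemma 11.41: the Künneth components of a Hodge class are morphisms of Hodge
structures). Proof: by Lemma 7.30 it suffices that `(Σᵢ B(x, uᵢ) vᵢ) ∪ β = 0` for `β` pure of type
non-complementary to that of `x`; that class is `(Σᵢ B(vᵢ, β) B(uᵢ, x)) • p`, and
`z ∪ (fst^* β ∪ snd^* x) = (Σᵢ B(vᵢ, β) B(uᵢ, x)) • (fst^* p ∪ snd^* p)` (`normalForm_cup_cross`)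
vanishes because `z` is `(2,2)` and `fst^* β ∪ snd^* x` is of non-complementary type on `S ⊗ S`
(`cupProduct_eq_zero_of_hodgeType`), while `fst^* p ∪ snd^* p ≠ 0`.
[cite: VoisinHodgeI2002, §11.3.3 Lemma 11.41 and Lemma 7.30] -/
theorem isOfHodgeType_act_of_normalForm {ι : Type} [Fintype ι] {v u : ι → complexBetti S (2 * 1)}
    {t₄ t₀ : ℂ} {z : complexBetti (S ⊗ S) (2 * 2)} (hz : IsOfHodgeType 4 (S ⊗ S) (2 * 2) 2 2 z)
    (hzn : z = (∑ i, cupProduct (rfl : 2 * 1 + 2 * 1 = 2 * 2) (complexBetti.map (fst S S) (2 * 1) (v i))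
        (complexBetti.map (snd S S) (2 * 1) (u i))) +
      t₄ • complexBetti.map (snd S S) (2 * 2) p + t₀ • complexBetti.map (fst S S) (2 * 2) p)
    {i j : ℕ} {x : complexBetti S (2 * 1)} (hx : IsOfHodgeType 2 S (2 * 1) i j x) :
    IsOfHodgeType 2 S (2 * 1) i j (∑ k, B x (u k) • v k) := by
  have hI := hodgePQ_independent_of_hodgeModel_holds
  have hP := IsSmoothProjective.tensor_holds hS hS
  refine ⟨A, A.mem_hodgePQ_of_forall_cupPairing_eq_zero hI μ hS hcupS
    (rfl : 2 * 1 + 2 * 1 = 2 * 2) fun p' q' β hne hβ ↦ ?_⟩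
  -- `(Σ B(x,uₖ) vₖ) ∪ β = (Σ B(vₖ,β) B(uₖ,x)) • p`
  have hcup : cupProduct (rfl : 2 * 1 + 2 * 1 = 2 * 2) (∑ k, B x (u k) • v k) β =
      (∑ k, B (v k) β * B (u k) x) • p := by
    simp only [map_sum, map_smul, LinearMap.sum_apply, LinearMap.smul_apply, hB, smul_smul,
      Finset.sum_smul]
    exact Finset.sum_congr rfl fun k _ ↦ by rw [hBs x (u k), mul_comm (B (u k) x) (B (v k) β)]
  -- `z ∪ (fst^* β ∪ snd^* x) = 0` by types on `S ⊗ S`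
  have hzero : cupProduct (rfl : 2 * 2 + 2 * 2 = 2 * 4) z
      (cupProduct (rfl : 2 * 1 + 2 * 1 = 2 * 2) (complexBetti.map (fst S S) (2 * 1) β)
        (complexBetti.map (snd S S) (2 * 1) x)) = 0 := by
    have hβx : IsOfHodgeType 4 (S ⊗ S) (2 * 2) (p' + i) (q' + j)
        (cupProduct (rfl : 2 * 1 + 2 * 1 = 2 * 2) (complexBetti.map (fst S S) (2 * 1) β)
          (complexBetti.map (snd S S) (2 * 1) x)) :=
      isOfHodgeType_cross hS M hcupP rfl ⟨A, hβ⟩ hx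
    refine cupProduct_eq_zero_of_hodgeType hI hP M hcupP (rfl : 2 * 2 + 2 * 2 = 2 * 4) ?_
      ((hI.isOfHodgeType_iff hP M).1 hz) ((hI.isOfHodgeType_iff hP M).1 hβx)
    omega
  have hcoef : (∑ k, B (v k) β * B (u k) x) = 0 := by
    rw [hzn, normalForm_cup_cross hS hB] at hzero
    exact (smul_eq_zero.1 hzero).resolve_right hpp
  rw [cupPairing_apply, hcup, hcoef, zero_smul, map_zero, LinearMap.zero_apply]

/-- **The endomorphism `x ↦ Σᵢ B(x, vᵢ) • uᵢ` (the transpose) read off from a `(2,2)`-class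
`z = Σᵢ fst^* vᵢ ∪ snd^* uᵢ + t₄ • snd^* p + t₀ • fst^* p` of `S ⊗ S` preserves Hodge types on
`H²(S(ℂ); ℂ)`** — the same argument with the test class `fst^* x ∪ snd^* β`.
[cite: VoisinHodgeI2002, §11.3.3 Lemma 11.41 and Lemma 7.30] -/
theorem isOfHodgeType_coact_of_normalForm {ι : Type} [Fintype ι] {v u : ι → complexBetti S (2 * 1)}
    {t₄ t₀ : ℂ} {z : complexBetti (S ⊗ S) (2 * 2)} (hz : IsOfHodgeType 4 (S ⊗ S) (2 * 2) 2 2 z)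
    (hzn : z = (∑ i, cupProduct (rfl : 2 * 1 + 2 * 1 = 2 * 2) (complexBetti.map (fst S S) (2 * 1) (v i))
        (complexBetti.map (snd S S) (2 * 1) (u i))) +
      t₄ • complexBetti.map (snd S S) (2 * 2) p + t₀ • complexBetti.map (fst S S) (2 * 2) p)
    {i j : ℕ} {x : complexBetti S (2 * 1)} (hx : IsOfHodgeType 2 S (2 * 1) i j x) :
    IsOfHodgeType 2 S (2 * 1) i j (∑ k, B x (v k) • u k) := by
  have hI := hodgePQ_independent_of_hodgeModel_holds
  have hP := IsSmoothProjective.tensor_holds hS hS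
  refine ⟨A, A.mem_hodgePQ_of_forall_cupPairing_eq_zero hI μ hS hcupS
    (rfl : 2 * 1 + 2 * 1 = 2 * 2) fun p' q' β hne hβ ↦ ?_⟩
  have hcup : cupProduct (rfl : 2 * 1 + 2 * 1 = 2 * 2) (∑ k, B x (v k) • u k) β =
      (∑ k, B (v k) x * B (u k) β) • p := by
    simp only [map_sum, map_smul, LinearMap.sum_apply, LinearMap.smul_apply, hB, smul_smul,
      Finset.sum_smul]
    exact Finset.sum_congr rfl fun k _ ↦ by rw [hBs x (v k)]
  have hzero : cupProduct (rfl : 2 * 2 + 2 * 2 = 2 * 4) z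
      (cupProduct (rfl : 2 * 1 + 2 * 1 = 2 * 2) (complexBetti.map (fst S S) (2 * 1) x)
        (complexBetti.map (snd S S) (2 * 1) β)) = 0 := by
    have hxβ : IsOfHodgeType 4 (S ⊗ S) (2 * 2) (i + p') (j + q')
        (cupProduct (rfl : 2 * 1 + 2 * 1 = 2 * 2) (complexBetti.map (fst S S) (2 * 1) x)
          (complexBetti.map (snd S S) (2 * 1) β)) :=
      isOfHodgeType_cross hS M hcupP rfl hx ⟨A, hβ⟩
    refine cupProduct_eq_zero_of_hodgeType hI hP M hcupP (rfl : 2 * 2 + 2 * 2 = 2 * 4) ?_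
      ((hI.isOfHodgeType_iff hP M).1 hz) ((hI.isOfHodgeType_iff hP M).1 hxβ)
    omega
  have hcoef : (∑ k, B (v k) x * B (u k) β) = 0 := by
    rw [hzn, normalForm_cup_cross hS hB] at hzero
    exact (smul_eq_zero.1 hzero).resolve_right hpp
  rw [cupPairing_apply, hcup, hcoef, zero_smul, map_zero, LinearMap.zero_apply]

/-! ### Degrees `2` and `6`: the Künneth components of a `(1,1)`- resp. `(3,3)`-class are `(1,1)` -/

omit hBs in
/-- **The components `a`, `b` of a `(1,1)`-class `fst^* a + snd^* b` of `H²((S ⊗ S)(ℂ); ℂ)` are of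
type `(1,1)`** (Voisin I, Lemma 11.41 in degree `2`): test `a` against `fst^* β ∪ snd^* p` and `b`
against `fst^* p ∪ snd^* β` for `β` pure of type `≠ (1,1)` — the cup products are
`B(a, β) • (fst^* p ∪ snd^* p)`, resp. `B(b, β) • (fst^* p ∪ snd^* p)`, and vanish by the types on
`S ⊗ S`; conclude by Lemma 7.30 on `S`. [cite: VoisinHodgeI2002, §11.3.3 Lemma 11.41 and Lemma 7.30] -/
theorem isOfHodgeType_of_kunneth_two {z : complexBetti (S ⊗ S) (2 * 1)} {a b : complexBetti S (2 * 1)}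
    (hz : IsOfHodgeType 4 (S ⊗ S) (2 * 1) 1 1 z)
    (hzn : z = complexBetti.map (fst S S) (2 * 1) a + complexBetti.map (snd S S) (2 * 1) b) :
    IsOfHodgeType 2 S (2 * 1) 1 1 a ∧ IsOfHodgeType 2 S (2 * 1) 1 1 b := by
  have hI := hodgePQ_independent_of_hodgeModel_holds
  have hP := IsSmoothProjective.tensor_holds hS hS
  have hp22 : IsOfHodgeType 2 S (2 * 2) 2 2 p := isOfHodgeType_top_two_two A p
  have hz' := (hI.isOfHodgeType_iff hP M).1 hz
  constructor
  · refine ⟨A, A.mem_hodgePQ_of_forall_cupPairing_eq_zero hI μ hS hcupS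
      (rfl : 2 * 1 + 2 * 1 = 2 * 2) fun p' q' β hne hβ ↦ ?_⟩
    -- `z ∪ (fst^* β ∪ snd^* p) = B(a, β) • (fst^* p ∪ snd^* p)` vanishes by types
    have htest : IsOfHodgeType 4 (S ⊗ S) (2 * 3) (p' + 2) (q' + 2)
        (cupProduct (rfl : 2 * 1 + 2 * 2 = 2 * 3) (complexBetti.map (fst S S) (2 * 1) β)
          (complexBetti.map (snd S S) (2 * 2) p)) :=
      isOfHodgeType_cross hS M hcupP rfl ⟨A, hβ⟩ hp22
    have hzero := cupProduct_eq_zero_of_hodgeType hI hP M hcupP (rfl : 2 * 1 + 2 * 3 = 2 * 4)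
      (show ¬ (1 + (p' + 2) = 4 ∧ 1 + (q' + 2) = 4) by omega) hz' ((hI.isOfHodgeType_iff hP M).1 htest)
    rw [hzn, kunnethTwo_cup_cross_top hS hB] at hzero
    rw [cupPairing_apply, hB a β, (smul_eq_zero.1 hzero).resolve_right hpp, zero_smul, map_zero,
      LinearMap.zero_apply]
  · refine ⟨A, A.mem_hodgePQ_of_forall_cupPairing_eq_zero hI μ hS hcupS
      (rfl : 2 * 1 + 2 * 1 = 2 * 2) fun p' q' β hne hβ ↦ ?_⟩
    -- `z ∪ (fst^* p ∪ snd^* β) = B(b, β) • (fst^* p ∪ snd^* p)` vanishes by types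
    have htest : IsOfHodgeType 4 (S ⊗ S) (2 * 3) (2 + p') (2 + q')
        (cupProduct (rfl : 2 * 2 + 2 * 1 = 2 * 3) (complexBetti.map (fst S S) (2 * 2) p)
          (complexBetti.map (snd S S) (2 * 1) β)) :=
      isOfHodgeType_cross hS M hcupP rfl hp22 ⟨A, hβ⟩
    have hzero := cupProduct_eq_zero_of_hodgeType hI hP M hcupP (rfl : 2 * 1 + 2 * 3 = 2 * 4)
      (show ¬ (1 + (2 + p') = 4 ∧ 1 + (2 + q') = 4) by omega) hz' ((hI.isOfHodgeType_iff hP M).1 htest)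
    rw [hzn, kunnethTwo_cup_top_cross hS hB] at hzero
    rw [cupPairing_apply, hB b β, (smul_eq_zero.1 hzero).resolve_right hpp, zero_smul, map_zero,
      LinearMap.zero_apply]

omit hBs in
/-- **The components `a`, `b` of a `(3,3)`-class `fst^* a ∪ snd^* p + fst^* p ∪ snd^* b` of
`H⁶((S ⊗ S)(ℂ); ℂ)` are of type `(1,1)`** (Voisin I, Lemma 11.41 in degree `6`): test against
`fst^* β`, resp. `snd^* β`, for `β` pure of type `≠ (1,1)`. [cite: VoisinHodgeI2002, §11.3.3 Lemma 11.41 and Lemma 7.30] -/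
theorem isOfHodgeType_of_kunneth_six {z : complexBetti (S ⊗ S) (2 * 3)} {a b : complexBetti S (2 * 1)}
    (hz : IsOfHodgeType 4 (S ⊗ S) (2 * 3) 3 3 z)
    (hzn : z = cupProduct (rfl : 2 * 1 + 2 * 2 = 2 * 3) (complexBetti.map (fst S S) (2 * 1) a)
            (complexBetti.map (snd S S) (2 * 2) p) +
          cupProduct (rfl : 2 * 2 + 2 * 1 = 2 * 3) (complexBetti.map (fst S S) (2 * 2) p)
            (complexBetti.map (snd S S) (2 * 1) b)) :
    IsOfHodgeType 2 S (2 * 1) 1 1 a ∧ IsOfHodgeType 2 S (2 * 1) 1 1 b := by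
  have hI := hodgePQ_independent_of_hodgeModel_holds
  have hP := IsSmoothProjective.tensor_holds hS hS
  have hz' := (hI.isOfHodgeType_iff hP M).1 hz
  constructor
  · refine ⟨A, A.mem_hodgePQ_of_forall_cupPairing_eq_zero hI μ hS hcupS
      (rfl : 2 * 1 + 2 * 1 = 2 * 2) fun p' q' β hne hβ ↦ ?_⟩
    have htest : IsOfHodgeType 4 (S ⊗ S) (2 * 1) p' q' (complexBetti.map (fst S S) (2 * 1) β) :=
      IsOfHodgeType.map_of_independent hI ⟨A, hβ⟩ hP hS M (fst S S)
    have hzero := cupProduct_eq_zero_of_hodgeType hI hP M hcupP (rfl : 2 * 3 + 2 * 1 = 2 * 4)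
      (show ¬ (3 + p' = 4 ∧ 3 + q' = 4) by omega) hz' ((hI.isOfHodgeType_iff hP M).1 htest)
    rw [hzn, kunnethSix_cup_map_fst hS hB] at hzero
    rw [cupPairing_apply, hB a β, (smul_eq_zero.1 hzero).resolve_right hpp, zero_smul, map_zero,
      LinearMap.zero_apply]
  · refine ⟨A, A.mem_hodgePQ_of_forall_cupPairing_eq_zero hI μ hS hcupS
      (rfl : 2 * 1 + 2 * 1 = 2 * 2) fun p' q' β hne hβ ↦ ?_⟩
    have htest : IsOfHodgeType 4 (S ⊗ S) (2 * 1) p' q' (complexBetti.map (snd S S) (2 * 1) β) :=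
      IsOfHodgeType.map_of_independent hI ⟨A, hβ⟩ hP hS M (snd S S)
    have hzero := cupProduct_eq_zero_of_hodgeType hI hP M hcupP (rfl : 2 * 3 + 2 * 1 = 2 * 4)
      (show ¬ (3 + p' = 4 ∧ 3 + q' = 4) by omega) hz' ((hI.isOfHodgeType_iff hP M).1 htest)
    rw [hzn, kunnethSix_cup_map_snd hS hB] at hzero
    rw [cupPairing_apply, hB b β, (smul_eq_zero.1 hzero).resolve_right hpp, zero_smul, map_zero,
      LinearMap.zero_apply]

end TypeTwoTwo

end Summit.HodgeConjecture.HodgeConjecture.Theorems.NikulinTwinTransport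

end
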